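import Mathlib
import Summits.PneNP.PneNP.Theorems.WitnessForgingSatBridgeOracleElim
import Summits.PneNP.PneNP.Theorems.WitnessForgingSatBridgeDefs
import Summits.PneNP.PneNP.Theorems.WitnessForgingSatBridgeCounts
import Summits.PneNP.PneNP.Theorems.WitnessForgingSatBridgePolyTime
import Summits.PneNP.PneNP.Theorems.WitnessForgingSatBridgeCoin
import Summits.PneNP.PneNP.Theorems.WitnessForgingSatBridgeRounds
import Summits.PneNP.PneNP.Theorems.WitnessForgingSatBridgePointwise

/-!
# Route WitnessForging — support item `SatBridge` (stmt-PneNP-2432): the proof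

`Summit.PneNP.PneNP.Theses.WitnessForging.SatBridge` — **almost-uniform generation of SAT witnesses
from `NP ⊆ BPP`** (Jerrum–Valiant–Vazirani 1986 via Stockmeyer's approximate counting; Arora–Barak
2009 §7.4.1 for the oracle elimination): if `NP ⊆ BPP` then for every polynomial `s` there is a
probabilistic polynomial-time `A : RandAlg {0,1}* {0,1}*` whose output law on every satisfiable
compact CNF `φ` is within total-variation distance `1/(s(|enc φ|)+1)` of the uniform measure on the
solutions of `φ`.

Assembly of the parts: the approximate counter of the extension counts (`exists_counter`,
`…Counts`), made oracle-free (`oracle_elimination`, `…OracleElim`), drives the bit-by-bit sampler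
`samplerJVV` (`…Defs`), which is polynomial time (`codeFP_samplerJVV`, `…PolyTime`); its law is
bounded below pointwise by `(1-δ)/#Sol` (`pointwise_lower`, from `step_prob_ge`, `rounds_prob_ge`
and the fibrewise bound over the oracle-simulation coins), whence the total-variation bound
(`tv_of_pointwise`, `…Prob`).
-/

set_option linter.dupNamespace false -- `Summit.PneNP.PneNP.…`: summit = sub-problem (D-0017)

namespace Summit.PneNP.PneNP.Theorems.SatBridgeJVV

open Literature.Computability.Complexity
open _root_.Computability Polynomial Finset
open Literature.Computability.Complexity.SumcheckMA (cnfE cnfE_eq)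

/-! ### The solution set as a finset; the parameter arithmetic -/

/-- **The parameter arithmetic**: with `D = s(N)+1`, `k = 12·N·D + 1`, `Lb = 2N + 3D`, `P = 3D` and
`1 ≤ n ≤ N`-free bookkeeping (`n ≤ N`, `1 ≤ N`), the three error terms are each `≤ 1/(3D)`:
`1 - 1/D ≤ (1 - 2^{-(P+1)})·(1 - n·(4/k + 2^n/2^{Lb}))`, and `4/k + 2^n/2^{Lb} ≤ 1`. [folklore] -/
theorem params_ok (N n sN : ℕ) (hn : n ≤ N) (hN : 1 ≤ N) :
    (4 : ℝ) / ((12 * N * (sN + 1) + 1 : ℕ) : ℝ) + 2 ^ n / 2 ^ (2 * N + 3 * (sN + 1)) ≤ 1 ∧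
    1 - 1 / ((sN : ℝ) + 1) ≤ (1 - 1 / 2 ^ (3 * (sN + 1) + 1)) *
      (1 - n * ((4 : ℝ) / ((12 * N * (sN + 1) + 1 : ℕ) : ℝ) + 2 ^ n / 2 ^ (2 * N + 3 * (sN + 1)))) := by
  set D : ℕ := sN + 1 with hD
  have hD1 : (1 : ℝ) ≤ D := by simp [hD]
  have hDpos : (0 : ℝ) < D := by linarith
  have hNR : (1 : ℝ) ≤ N := by exact_mod_cast hN
  have hnR : (n : ℝ) ≤ N := by exact_mod_cast hn
  have hk : ((12 * N * (sN + 1) + 1 : ℕ) : ℝ) = 12 * N * D + 1 := by push_cast [hD]; ring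
  rw [hk]
  have hkpos : (0 : ℝ) < 12 * N * D + 1 := by positivity
  -- `2^n ≤ 2^N`, `N < 2^N`, `3D < 2^{3D}`
  have h2n : (2 : ℝ) ^ n ≤ 2 ^ N := pow_le_pow_right₀ (by norm_num) hn
  have h2N : (N : ℝ) < 2 ^ N := by exact_mod_cast Nat.lt_two_pow_self
  have h3D : ((3 * D : ℕ) : ℝ) < 2 ^ (3 * D) := by exact_mod_cast Nat.lt_two_pow_self
  push_cast at h3D
  have hsplit : (2 : ℝ) ^ (2 * N + 3 * (sN + 1)) = 2 ^ N * 2 ^ N * 2 ^ (3 * D) := by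
    rw [show 2 * N + 3 * (sN + 1) = N + N + 3 * D by rw [hD]; ring, pow_add, pow_add]
  have hP : (2 : ℝ) ^ (3 * (sN + 1) + 1) = 2 ^ (3 * D) * 2 := by rw [← hD, pow_succ]
  rw [hsplit, hP]
  have h2Npos : (0 : ℝ) < 2 ^ N := by positivity
  have h23D : (0 : ℝ) < 2 ^ (3 * D) := by positivity
  -- term 1: `4/k ≤ 1/(3D)` and `n · 4/k ≤ 1/(3D)`
  have t1 : (n : ℝ) * (4 / (12 * N * D + 1)) ≤ 1 / (3 * D) := by
    rw [mul_div_assoc', div_le_div_iff₀ hkpos (by positivity)]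
    nlinarith
  have t1' : (4 : ℝ) / (12 * N * D + 1) ≤ 1 / 2 := by
    rw [div_le_div_iff₀ hkpos (by norm_num)]; nlinarith
  -- term 2: `n 2^n/2^{Lb} ≤ 1/(3D)` and `2^n/2^{Lb} ≤ 1/2`
  have t2 : (n : ℝ) * (2 ^ n / (2 ^ N * 2 ^ N * 2 ^ (3 * D))) ≤ 1 / (3 * D) := by
    rw [mul_div_assoc', div_le_div_iff₀ (by positivity) (by positivity)]
    have : (n : ℝ) * 2 ^ n ≤ 2 ^ N * 2 ^ N := by
      have := mul_le_mul (hnR.trans h2N.le) h2n (by positivity) h2Npos.le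
      linarith
    nlinarith [this, h3D]
  have t2' : (2 : ℝ) ^ n / (2 ^ N * 2 ^ N * 2 ^ (3 * D)) ≤ 1 / 2 := by
    rw [div_le_div_iff₀ (by positivity) (by norm_num)]
    have h8 : (2 : ℝ) ≤ 2 ^ (3 * D) := by
      calc (2 : ℝ) = 2 ^ 1 := by norm_num
        _ ≤ 2 ^ (3 * D) := pow_le_pow_right₀ (by norm_num) (by simp [hD]; omega)
    have h1N : (1 : ℝ) ≤ 2 ^ N := one_le_pow₀ (by norm_num)
    nlinarith [mul_le_mul h2n h1N (by norm_num) (by positivity), mul_nonneg (by positivity : (0:ℝ) ≤ 2 ^ N * 2 ^ N) (by linarith : (0:ℝ) ≤ 2 ^ (3 * D) - 2)]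
  -- term 3: `1/2^{P+1} ≤ 1/(3D)`
  have t3 : (1 : ℝ) / (2 ^ (3 * D) * 2) ≤ 1 / (3 * D) := by
    rw [div_le_div_iff₀ (by positivity) (by positivity)]; nlinarith
  refine ⟨by linarith, ?_⟩
  -- `(1-ε)(1 - n x) ≥ 1 - ε - n x ≥ 1 - 1/D`
  set ε : ℝ := 1 / (2 ^ (3 * D) * 2) with hε
  set xx : ℝ := 4 / (12 * N * D + 1) + 2 ^ n / (2 ^ N * 2 ^ N * 2 ^ (3 * D)) with hxx
  have hε0 : 0 ≤ ε := by positivity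
  have hnx0 : 0 ≤ (n : ℝ) * xx := by positivity
  have hnx : (n : ℝ) * xx ≤ 2 / (3 * D) := by
    have : (n : ℝ) * xx = n * (4 / (12 * N * D + 1)) + n * (2 ^ n / (2 ^ N * 2 ^ N * 2 ^ (3 * D))) := by
      rw [hxx]; ring
    rw [this]
    have : (2 : ℝ) / (3 * D) = 1 / (3 * D) + 1 / (3 * D) := by ring
    linarith
  have hDinv : (1 : ℝ) / ((sN : ℝ) + 1) = 3 * (1 / (3 * D)) := by
    rw [hD]; push_cast; field_simp
  calc 1 - 1 / ((sN : ℝ) + 1) = 1 - 1 / (3 * D) - 2 / (3 * D) := by rw [hDinv]; ring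
    _ ≤ 1 - ε - n * xx := by linarith
    _ ≤ (1 - ε) * (1 - n * xx) := by nlinarith

/-! ### The theorem -/

/-- **Item stmt-PneNP-2432 (`SatBridge`, route WitnessForging) — almost-uniform generation of SAT
witnesses from `NP ⊆ BPP`.** If
`Nondeterministic.NP ⊆ BPP` then for every polynomial `s` there is a probabilistic polynomial-time
`A : RandAlg {0,1}* {0,1}*` such that for every satisfiable CNF `φ` with `numVars φ ≤ |enc φ|` and
every event `E`, `|Pr[A(enc φ) ∈ E] - μ_φ(E)| ≤ 1/(s(|enc φ|)+1)`, `μ_φ` the uniform measure on the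
solutions of `φ` as bit strings of length `numVars φ`. The algorithm is the Jerrum–Valiant–Vazirani
bit-by-bit sampler (`samplerJVV`) driven by Stockmeyer's approximate counter of the extension
counts (`exists_counter`, tree theorem `StockMachine.stockmeyerApproxCounting_holds`), whose
`NP`-oracle is eliminated under `NP ⊆ BPP` (`oracle_elimination`); it is polynomial time by
`codeFP_samplerJVV`, and its law is within `1/(s+1)` of uniform by `pointwise_lower` (a one-sided
pointwise bound) and `tv_of_pointwise`.
[cite: JerrumValiantVazirani1986, §3 (Thm. 3.3); Stockmeyer1985; AroraBarak2009, §7.4.1] -/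
theorem _root_.Summit.PneNP.PneNP.Theorems.satBridge_proof :
    Summit.PneNP.PneNP.Theses.WitnessForging.SatBridge := by
  intro hNP s
  classical
  obtain ⟨L, hLNP, F, hF, c, hc⟩ := exists_counter
  obtain ⟨Fst, hFst, τ, hτ⟩ := oracle_elimination (hNP hLNP) hF
  -- size parameters, all polynomials of `N = |x|`
  set kk : Polynomial ℕ := 12 * X * (s + 1) + 1 with hkk
  set Lb : Polynomial ℕ := 2 * X + 3 * (s + 1) with hLb
  set P : Polynomial ℕ := 3 * (s + 1) with hP
  set U : Polynomial ℕ := c.comp (4 * X + 3 + 2 * kk) with hU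
  set T : Polynomial ℕ := τ.comp ((16 * X + 22 + 6 * kk + U) + P) with hT
  set CL : Polynomial ℕ := T + X * (2 * U + Lb) with hCL
  obtain ⟨f, hf, hfeq⟩ := codeFP_samplerJVV hFst c kk Lb P T U
  refine ⟨⟨fun x ω => f (boolPair x ω), fun m => CL.eval m⟩,
    AdBPPSim.isPolyTime_of_FP hf CL (fun x r => rfl), fun φ hφ hφn E => ?_⟩
  set x := encodingCNF.encode φ with hx
  set N := x.length with hN
  set n := φ.numVars with hn
  -- the output law is the law of the sampler
  rw [RandAlg.pr_eq_uniformProb]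
  have hrun : ∀ ω : List Bool, f (boolPair x ω) = samplerJVV Fst c kk Lb P T U x n ω := by
    intro ω
    have h := hfeq (φ, ω)
    simp only [CodeFP.pairE_apply] at h
    rw [← cnfE_eq, min_eq_left hφn] at h
    exact h
  have hset : {ω : List Bool | (RandAlg.mk (fun x ω => f (boolPair x ω)) (fun m => CL.eval m)).run x ω ∈ E} =
      {ω | samplerJVV Fst c kk Lb P T U x n ω ∈ E} := by
    ext ω; simp only [Set.mem_setOf_eq, hrun]
  rw [show (id x : List Bool) = x from rfl, hset]
  -- the finite solution set
  set S : Finset (List Bool) := ((Finset.univ : Finset (List.Vector Bool n)).image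
    fun v => v.toList).filter (fun y => φ.eval (fun i => y.getD i false) = true) with hS
  have hScoe : (S : Set (List Bool)) = Sol φ := by
    ext y
    simp only [hS, Finset.coe_filter, Finset.mem_image, Finset.mem_univ, true_and, Set.mem_setOf_eq,
      mem_Sol_iff]
    constructor
    · rintro ⟨⟨v, rfl⟩, h⟩; exact ⟨v.toList_length, h⟩
    · rintro ⟨hl, h⟩; exact ⟨⟨⟨y, hl⟩, rfl⟩, h⟩
  have hSol : {y : List Bool | y.length = φ.numVars ∧ φ.eval (fun i => y.getD i false) = true} = Sol φ := rfl
  have hSE : (Sol φ ∩ E).ncard = (S.filter (· ∈ E)).card := by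
    rw [← Set.ncard_coe_finset]; congr 1
    rw [Finset.coe_filter, ← hScoe]; rfl
  have hScard : (Sol φ).ncard = S.card := by rw [← hScoe, Set.ncard_coe_finset]
  have hScardE : S.card = extCount φ [] := by
    have h1 : S = ((Finset.univ : Finset (List.Vector Bool n)).filter
        fun v => φ.eval (fun i => v.toList.getD i false) = true).image fun v => v.toList := by
      rw [hS, Finset.filter_image]
    rw [h1, Finset.card_image_of_injective _ List.Vector.toList_injective]
    unfold extCount cnt
    simp only [List.nil_append, List.length_nil, Nat.sub_zero]
    refine congrArg Finset.card (Finset.filter_congr fun v _ => ?_)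
    simp [mem_Sol_iff]
  have hSne : S.Nonempty := by
    rw [← Finset.card_pos, hScardE]; exact extCount_nil_pos hφ
  rw [hSol, hSE, hScard]
  -- parameter facts at `N`
  have hN1 : 1 ≤ N := by
    have h2 : 2 ≤ (encodingCNF.encode φ).length := by
      rw [cnfE_eq]; simp only [CodeFP.listE, length_boolPair]; omega
    exact le_trans (by norm_num) h2
  have hkk_eval : kk.eval N = 12 * N * (s.eval N + 1) + 1 := by simp [hkk]
  have hLb_eval : Lb.eval N = 2 * N + 3 * (s.eval N + 1) := by simp [hLb, hP]
  have hP_eval : P.eval N = 3 * (s.eval N + 1) := by simp [hP]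
  have hU_eval : U.eval N = c.eval (4 * N + 3 + 2 * kk.eval N) := by simp [hU, eval_comp]
  have hT_eval : T.eval N = τ.eval ((16 * N + 22 + 6 * kk.eval N + U.eval N) + P.eval N) := by
    simp [hT, hU, eval_comp]
  have hCL_eval : CL.eval N = T.eval N + N * (2 * U.eval N + Lb.eval N) := by simp [hCL]
  obtain ⟨hx1, hfinal⟩ := params_ok N n (s.eval N) hφn hN1
  have hk : 0 < kk.eval N := by rw [hkk_eval]; exact Nat.succ_pos _
  -- pointwise bound
  have hpt : ∀ y ∈ S, (1 - 1 / (((s.eval N : ℕ) : ℝ) + 1)) / S.card ≤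
      uniformProb (CL.eval N) {ω | samplerJVV Fst c kk Lb P T U x n ω = y} := by
    intro y hyS
    have hy : y ∈ Sol φ := by rw [← hScoe]; exact hyS
    have hpl := pointwise_lower (F := F) (Fst := Fst) (c := c) (τ := τ) kk Lb P T U φ
      (fun w k hk' => hc φ w k hk') hτ hφn hk (le_of_eq hU_eval.symm) (le_of_eq hT_eval.symm)
      (by rw [hkk_eval, hLb_eval]; exact hx1) y hy
    rw [hCL_eval, hScardE]
    refine le_trans ?_ hpl
    rw [hkk_eval, hLb_eval, hP_eval]
    exact div_le_div_of_nonneg_right hfinal (by positivity)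
  have hδ : (0 : ℝ) ≤ 1 - (1 - 1 / (((s.eval N : ℕ) : ℝ) + 1)) := by
    have : (0 : ℝ) ≤ 1 / (((s.eval N : ℕ) : ℝ) + 1) := by positivity
    linarith
  have htv := tv_of_pointwise (samplerJVV Fst c kk Lb P T U x n) S hSne hδ
    (fun y hy => by rw [sub_sub_cancel]; exact hpt y hy) E
  rw [sub_sub_cancel] at htv
  exact htv

end Summit.PneNP.PneNP.Theorems.SatBridgeJVV

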